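import Summits.ValiantsHypothesis.ValiantsHypothesis.Theorems.LacunarySymmetroidMatrixDescartesCensusV19TSoundCerts
import Summits.ValiantsHypothesis.ValiantsHypothesis.Theorems.LacunarySymmetroidMatrixDescartesCensusV19GSoundNineteen

/-!
# `MatrixDescartes` census — soundness of the `V19T` checker: the support theorems

HONEST FRAMING.  Object-search cell `pub-symmetroid`; door-A item `DoorA26 = PosRootLawAt 2 6 19` (stmt-ValiantsHypothesis-19979; OPEN, typed,
never asserted) and its sharper support rows `PosRootLawOn 2 6 18 d`.  PROOFS, no new definitions (val-sym-door-p4 g6): a pencil with `19` distinct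
positive det-roots on a 2-Sidon support (given the `V = 20` row of the support) yields a `V19G.Model` of the cell it realises — val-sym-door-p5 g5's
`V19G.model_of_nineteen`, unchanged — and no `V19G.Model` passes a certificate accepted by `V19T.topOK` (`…CensusV19TSoundCerts`); hence
(`posRootLawOn_of_certs`, `posRootLawOn_of_slices8`, the eight-slice shape of `V19S` / `V19G`): if every well-formed cell of a support carries a
certificate accepted by `V19T.checkCells` and the support has no twenty, it has no nineteen — `ζ(2,6; d) ≤ 18`.  Nothing here bears on the
one-collision supports, on `ζ_sym(2,6)` over all supports, on `MatrixDescartes` (stmt-ValiantsHypothesis-18050) or on `VP ≠ VNP`.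

[folklore] Certificate-checker soundness; elementary.
-/

-- the D-0017 layout repeats a namespace component (single-conjunct summit); the `dupNamespace` linter flags it; name mandated.
set_option linter.dupNamespace false

namespace Summit.ValiantsHypothesis.ValiantsHypothesis.Theorems.LacunarySymmetroidMatrixDescartes.Census.V19T

open Polynomial
open V20 (Atom sortAtoms ordOK pdet dfun aval)
open V19S (Ctx Mode mkCtx sliceA sliceB mem_sliceA mem_sliceB)

section Nineteen

/-- What `cellsOK` establishes: every listed cell carries an accepted top-level certificate. [folklore] -/
theorem cellsOK_spec (d : List ℕ) (ord : List Atom) :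
    ∀ (L : List (Bool × Mode)) (cs : List Top), cellsOK d ord L cs = true →
      ∀ (s : Bool) (m : Mode), (s, m) ∈ L → ∃ ct, topOK (mkCtx d ord s m none) ct = true
  | [], _, _, s, m, hsm => by simp at hsm
  | (s', m') :: L, [], h, _, _, _ => by simp [cellsOK] at h
  | (s', m') :: L, ct :: cs, h, s, m, hsm => by
    simp only [cellsOK, Bool.and_eq_true] at h
    rcases List.mem_cons.1 hsm with he | hsm
    · simp only [Prod.mk.injEq] at he
      obtain ⟨rfl, rfl⟩ := he
      exact ⟨ct, h.1.2⟩
    · exact cellsOK_spec d ord L cs h.2 s m hsm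

/-- What `checkCells` establishes: the order passed, and every listed cell carries an accepted top-level certificate. [folklore] -/
theorem checkCells_spec {dl : List ℕ} {L : List (Bool × Mode)} {cs : List Top} (h : checkCells dl L cs = true) :
    ordOK dl (sortAtoms dl) = true ∧ ∀ (s : Bool) (m : Mode), (s, m) ∈ L → ∃ ct, topOK (mkCtx dl (sortAtoms dl) s m none) ct = true := by
  unfold checkCells at h
  simp only [Bool.and_eq_true] at h
  exact ⟨h.1, cellsOK_spec dl (sortAtoms dl) L cs h.2⟩

/-- **Soundness of the `V19T` checker**: if every well-formed cell of a support passing `V20.ordOK` carries an accepted top-level certificate,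
and the support has no twenty, then it has no nineteen — `ζ(2,6; d) ≤ 18`. [folklore] -/
theorem posRootLawOn_of_certs (dl : List ℕ) (hord : ordOK dl (sortAtoms dl) = true)
    (hall : ∀ (s : Bool) (m : Mode), m.ok = true → ∃ ct, topOK (mkCtx dl (sortAtoms dl) s m none) ct = true)
    (h20 : PosRootLawOn 2 6 19 (fun i => dl.getD i 0)) : PosRootLawOn 2 6 18 (fun i => dl.getD i 0) := by
  intro S hS
  by_contra hlt
  have h19 : 19 ≤ ((pdet dl S).roots.toFinset.filter (fun t => 0 < t)).card := by
    unfold pdet dfun; push Not at hlt; exact hlt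
  obtain ⟨s, m, x, hm, M⟩ := V19G.model_of_nineteen hord hS h19 h20
  obtain ⟨ct, hct⟩ := hall s m hm
  exact topOK_sound M hct

/-- **Soundness, eight-slice form** (the shape of the data files): the `82` cells of a support split as Case A `k < 10` / `10 ≤ k < 20` and
Case B `z < 11` / `11 ≤ z ≤ 20` in both orientations; if each slice passes `V19T.checkCells` and the support has no twenty, it has no nineteen.
[folklore] -/
theorem posRootLawOn_of_slices8 {dl : List ℕ} {c1 c2 c3 c4 c5 c6 c7 c8 : List Top}
    (h1 : checkCells dl (sliceA true 0 10) c1 = true) (h2 : checkCells dl (sliceA true 10 20) c2 = true)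
    (h3 : checkCells dl (sliceA false 0 10) c3 = true) (h4 : checkCells dl (sliceA false 10 20) c4 = true)
    (h5 : checkCells dl (sliceB true 0 11) c5 = true) (h6 : checkCells dl (sliceB true 11 21) c6 = true)
    (h7 : checkCells dl (sliceB false 0 11) c7 = true) (h8 : checkCells dl (sliceB false 11 21) c8 = true)
    (h20 : PosRootLawOn 2 6 19 (fun i => dl.getD i 0)) : PosRootLawOn 2 6 18 (fun i => dl.getD i 0) := by
  obtain ⟨hord, H1⟩ := checkCells_spec h1
  obtain ⟨-, H2⟩ := checkCells_spec h2
  obtain ⟨-, H3⟩ := checkCells_spec h3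
  obtain ⟨-, H4⟩ := checkCells_spec h4
  obtain ⟨-, H5⟩ := checkCells_spec h5
  obtain ⟨-, H6⟩ := checkCells_spec h6
  obtain ⟨-, H7⟩ := checkCells_spec h7
  obtain ⟨-, H8⟩ := checkCells_spec h8
  refine posRootLawOn_of_certs dl hord (fun s m hm => ?_) h20
  cases m with
  | A k =>
    have hk : k < 20 := by simpa [Mode.ok] using hm
    cases s with
    | false =>
      by_cases hk10 : k < 10
      · exact H3 false (.A k) (mem_sliceA false (Nat.zero_le k) hk10)
      · exact H4 false (.A k) (mem_sliceA false (not_lt.1 hk10) hk)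
    | true =>
      by_cases hk10 : k < 10
      · exact H1 true (.A k) (mem_sliceA true (Nat.zero_le k) hk10)
      · exact H2 true (.A k) (mem_sliceA true (not_lt.1 hk10) hk)
  | B z =>
    have hz : z ≤ 20 := by simpa [Mode.ok] using hm
    cases s with
    | false =>
      by_cases hz11 : z < 11
      · exact H7 false (.B z) (mem_sliceB false (Nat.zero_le z) hz11)
      · exact H8 false (.B z) (mem_sliceB false (not_lt.1 hz11) (by omega))
    | true =>
      by_cases hz11 : z < 11
      · exact H5 true (.B z) (mem_sliceB true (Nat.zero_le z) hz11)
      · exact H6 true (.B z) (mem_sliceB true (not_lt.1 hz11) (by omega))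

end Nineteen

end Summit.ValiantsHypothesis.ValiantsHypothesis.Theorems.LacunarySymmetroidMatrixDescartes.Census.V19T
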